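import Summits.BirchSwinnertonDyer.BirchSwinnertonDyer.Theorems.Rank2ObservatoryRank2Table
import Summits.BirchSwinnertonDyer.BirchSwinnertonDyer.Theorems.Rank2ObservatoryRank2Rows60a
import Summits.BirchSwinnertonDyer.BirchSwinnertonDyer.Theorems.Rank2ObservatoryRank2Rows60b
import Summits.BirchSwinnertonDyer.BirchSwinnertonDyer.Theorems.Rank2ObservatoryRank2Rows61a
import Summits.BirchSwinnertonDyer.BirchSwinnertonDyer.Theorems.Rank2ObservatoryRank2Rows61b
import Summits.BirchSwinnertonDyer.BirchSwinnertonDyer.Theorems.Rank2ObservatoryRank2Rows62a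
import Summits.BirchSwinnertonDyer.BirchSwinnertonDyer.Theorems.Rank2ObservatoryRank2Rows62b
import Summits.BirchSwinnertonDyer.BirchSwinnertonDyer.Theorems.Rank2ObservatoryRank2Rows63a
import Summits.BirchSwinnertonDyer.BirchSwinnertonDyer.Theorems.Rank2ObservatoryRank2Rows63b
import Summits.BirchSwinnertonDyer.BirchSwinnertonDyer.Theorems.Rank2ObservatoryRank2Rows64a
import Summits.BirchSwinnertonDyer.BirchSwinnertonDyer.Theorems.Rank2ObservatoryRank2Rows64b
import Summits.BirchSwinnertonDyer.BirchSwinnertonDyer.Theorems.Rank2ObservatoryRank2Rows65a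
import Summits.BirchSwinnertonDyer.BirchSwinnertonDyer.Theorems.Rank2ObservatoryRank2Rows65b
import Summits.BirchSwinnertonDyer.BirchSwinnertonDyer.Theorems.Rank2ObservatoryRank2Rows66a
import Summits.BirchSwinnertonDyer.BirchSwinnertonDyer.Theorems.Rank2ObservatoryRank2Rows66b
import Summits.BirchSwinnertonDyer.BirchSwinnertonDyer.Theorems.Rank2ObservatoryRank2Rows67a
import Summits.BirchSwinnertonDyer.BirchSwinnertonDyer.Theorems.Rank2ObservatoryRank2Rows67b
import Summits.BirchSwinnertonDyer.BirchSwinnertonDyer.Theorems.Rank2ObservatoryRank2Rows68a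
import Summits.BirchSwinnertonDyer.BirchSwinnertonDyer.Theorems.Rank2ObservatoryRank2Rows68b
import Summits.BirchSwinnertonDyer.BirchSwinnertonDyer.Theorems.Rank2ObservatoryRank2Rows69a
import Summits.BirchSwinnertonDyer.BirchSwinnertonDyer.Theorems.Rank2ObservatoryRank2Rows69b
import HarnessLib

/-!
# BirchSwinnertonDyer — rank ≥ 2 observatory: rank-2 census table, decade 6 of 10 (`300000 ≤ N < 350000`)

HONEST FRAMING: per-curve certified theorems and census instruments; no claim on BSD in rank ≥ 2.

Machine-written AGGREGATION level of the rank-2 census (schema `Rank2ObservatoryRank2Table.lean`, data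
chunks `Rank2ObservatoryRank2Rows60a … 69b`, census `Rank2ObservatoryRank2Census.lean`): `rank2Decade6` is the
concatenation of the 20 chunks of conductor windows 60–69 (`300000 ≤ N < 350000`; a window above the gate's
200 kB file cap is stored as two half-window chunks `NNa`, `NNb`) — rows 199831–237177 of `rank2_table.tsv`
(sha256 `8b151c933b69ee8dae4834c21efd171353ae94c887716c05b7381d12d173f912`), 37347 curves from `300016b1` to
`349998d1`. Its theorems are assembled from the chunk theorems (each a kernel `decide`) by
`List.all_append` / `List.length_append` rewriting only; no row is re-evaluated here. The two-level
assembly (chunks → decades → table) keeps every file under the tree's 400-line limit and every list short.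

Reference: J. E. Cremona, *Algorithms for Modular Elliptic Curves* (2nd ed. 1997), tables / ecdata.
-/

-- single-conjunct summit: `Summit.BirchSwinnertonDyer.BirchSwinnertonDyer.…` repeats the name by design
set_option linter.dupNamespace false

namespace Summit.BirchSwinnertonDyer.BirchSwinnertonDyer.Rank2Observatory

/-- The 20 chunks of decade 6 (conductors `300000 ≤ N < 350000`), in order. [cite: CremonaAlgorithms1997, Tables] -/
noncomputable def rank2Decade6Chunks : List (List Rank2Row) := [
  rank2Rows60a, rank2Rows60b, rank2Rows61a, rank2Rows61b, rank2Rows62a, rank2Rows62b,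
  rank2Rows63a, rank2Rows63b, rank2Rows64a, rank2Rows64b, rank2Rows65a, rank2Rows65b,
  rank2Rows66a, rank2Rows66b, rank2Rows67a, rank2Rows67b, rank2Rows68a, rank2Rows68b,
  rank2Rows69a, rank2Rows69b]

/-- Decade 6 of the rank-2 census table: the 37347 rank-2 curves of conductor `300000 ≤ N < 350000` (rows 199831–237177).
[cite: CremonaAlgorithms1997, Tables] -/
noncomputable def rank2Decade6 : List Rank2Row :=
  rank2Decade6Chunks.flatten

/-- Every row of decade 6 satisfies `Rank2Row.check` (from the 20 chunk theorems). [folklore] -/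
theorem rank2Decade6_check : rank2Decade6.all Rank2Row.check = true := by
  simp only [rank2Decade6, rank2Decade6Chunks, List.flatten_cons, List.flatten_nil, List.all_append, List.all_nil,
    Bool.and_true,
    rank2Rows60a_check, rank2Rows60b_check, rank2Rows61a_check, rank2Rows61b_check,
    rank2Rows62a_check, rank2Rows62b_check, rank2Rows63a_check, rank2Rows63b_check,
    rank2Rows64a_check, rank2Rows64b_check, rank2Rows65a_check, rank2Rows65b_check,
    rank2Rows66a_check, rank2Rows66b_check, rank2Rows67a_check, rank2Rows67b_check,
    rank2Rows68a_check, rank2Rows68b_check, rank2Rows69a_check, rank2Rows69b_check]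

/-- Decade 6 has `37347` rows (sum of the 20 kernel-counted chunk lengths). [cite: CremonaAlgorithms1997, Tables] -/
theorem rank2Decade6_length : rank2Decade6.length = 37347 := by
  simp only [rank2Decade6, rank2Decade6Chunks, List.flatten_cons, List.flatten_nil, List.length_append, List.length_nil,
    rank2Rows60a_length, rank2Rows60b_length, rank2Rows61a_length, rank2Rows61b_length,
    rank2Rows62a_length, rank2Rows62b_length, rank2Rows63a_length, rank2Rows63b_length,
    rank2Rows64a_length, rank2Rows64b_length, rank2Rows65a_length, rank2Rows65b_length,
    rank2Rows66a_length, rank2Rows66b_length, rank2Rows67a_length, rank2Rows67b_length,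
    rank2Rows68a_length, rank2Rows68b_length, rank2Rows69a_length, rank2Rows69b_length]

/-- Every conductor of decade 6 is `< 500 000` (from the 20 kernel-checked chunk ranges).
[cite: CremonaAlgorithms1997, Tables] -/
theorem rank2Decade6_conductor_lt : rank2Decade6.all (fun r => decide (r.N < 500000)) = true := by
  simp only [rank2Decade6, rank2Decade6Chunks, List.flatten_cons, List.flatten_nil, List.all_append, List.all_nil,
    Bool.and_true,
    Rank2Row.all_conductorLt_of_all_range (by norm_num) rank2Rows60a_conductor,
    Rank2Row.all_conductorLt_of_all_range (by norm_num) rank2Rows60b_conductor,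
    Rank2Row.all_conductorLt_of_all_range (by norm_num) rank2Rows61a_conductor,
    Rank2Row.all_conductorLt_of_all_range (by norm_num) rank2Rows61b_conductor,
    Rank2Row.all_conductorLt_of_all_range (by norm_num) rank2Rows62a_conductor,
    Rank2Row.all_conductorLt_of_all_range (by norm_num) rank2Rows62b_conductor,
    Rank2Row.all_conductorLt_of_all_range (by norm_num) rank2Rows63a_conductor,
    Rank2Row.all_conductorLt_of_all_range (by norm_num) rank2Rows63b_conductor,
    Rank2Row.all_conductorLt_of_all_range (by norm_num) rank2Rows64a_conductor,
    Rank2Row.all_conductorLt_of_all_range (by norm_num) rank2Rows64b_conductor,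
    Rank2Row.all_conductorLt_of_all_range (by norm_num) rank2Rows65a_conductor,
    Rank2Row.all_conductorLt_of_all_range (by norm_num) rank2Rows65b_conductor,
    Rank2Row.all_conductorLt_of_all_range (by norm_num) rank2Rows66a_conductor,
    Rank2Row.all_conductorLt_of_all_range (by norm_num) rank2Rows66b_conductor,
    Rank2Row.all_conductorLt_of_all_range (by norm_num) rank2Rows67a_conductor,
    Rank2Row.all_conductorLt_of_all_range (by norm_num) rank2Rows67b_conductor,
    Rank2Row.all_conductorLt_of_all_range (by norm_num) rank2Rows68a_conductor,
    Rank2Row.all_conductorLt_of_all_range (by norm_num) rank2Rows68b_conductor,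
    Rank2Row.all_conductorLt_of_all_range (by norm_num) rank2Rows69a_conductor,
    Rank2Row.all_conductorLt_of_all_range (by norm_num) rank2Rows69b_conductor]

/-- A row of a chunk of decade 6 is a row of the decade. [folklore] -/
theorem mem_rank2Decade6_of_mem_chunk {l : List Rank2Row} (hl : l ∈ rank2Decade6Chunks) {r : Rank2Row} (hr : r ∈ l) :
    r ∈ rank2Decade6 :=
  List.mem_flatten.mpr ⟨l, hl, hr⟩

/-- Chunk 60a is a chunk of decade 6. [folklore] -/
theorem rank2Rows60a_mem_decade6 : rank2Rows60a ∈ rank2Decade6Chunks :=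
  List.mem_iff_getElem?.mpr ⟨0, rfl⟩

/-- Chunk 60b is a chunk of decade 6. [folklore] -/
theorem rank2Rows60b_mem_decade6 : rank2Rows60b ∈ rank2Decade6Chunks :=
  List.mem_iff_getElem?.mpr ⟨1, rfl⟩

/-- Chunk 61a is a chunk of decade 6. [folklore] -/
theorem rank2Rows61a_mem_decade6 : rank2Rows61a ∈ rank2Decade6Chunks :=
  List.mem_iff_getElem?.mpr ⟨2, rfl⟩

/-- Chunk 61b is a chunk of decade 6. [folklore] -/
theorem rank2Rows61b_mem_decade6 : rank2Rows61b ∈ rank2Decade6Chunks :=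
  List.mem_iff_getElem?.mpr ⟨3, rfl⟩

/-- Chunk 62a is a chunk of decade 6. [folklore] -/
theorem rank2Rows62a_mem_decade6 : rank2Rows62a ∈ rank2Decade6Chunks :=
  List.mem_iff_getElem?.mpr ⟨4, rfl⟩

/-- Chunk 62b is a chunk of decade 6. [folklore] -/
theorem rank2Rows62b_mem_decade6 : rank2Rows62b ∈ rank2Decade6Chunks :=
  List.mem_iff_getElem?.mpr ⟨5, rfl⟩

/-- Chunk 63a is a chunk of decade 6. [folklore] -/
theorem rank2Rows63a_mem_decade6 : rank2Rows63a ∈ rank2Decade6Chunks :=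
  List.mem_iff_getElem?.mpr ⟨6, rfl⟩

/-- Chunk 63b is a chunk of decade 6. [folklore] -/
theorem rank2Rows63b_mem_decade6 : rank2Rows63b ∈ rank2Decade6Chunks :=
  List.mem_iff_getElem?.mpr ⟨7, rfl⟩

/-- Chunk 64a is a chunk of decade 6. [folklore] -/
theorem rank2Rows64a_mem_decade6 : rank2Rows64a ∈ rank2Decade6Chunks :=
  List.mem_iff_getElem?.mpr ⟨8, rfl⟩

/-- Chunk 64b is a chunk of decade 6. [folklore] -/
theorem rank2Rows64b_mem_decade6 : rank2Rows64b ∈ rank2Decade6Chunks :=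
  List.mem_iff_getElem?.mpr ⟨9, rfl⟩

/-- Chunk 65a is a chunk of decade 6. [folklore] -/
theorem rank2Rows65a_mem_decade6 : rank2Rows65a ∈ rank2Decade6Chunks :=
  List.mem_iff_getElem?.mpr ⟨10, rfl⟩

/-- Chunk 65b is a chunk of decade 6. [folklore] -/
theorem rank2Rows65b_mem_decade6 : rank2Rows65b ∈ rank2Decade6Chunks :=
  List.mem_iff_getElem?.mpr ⟨11, rfl⟩

/-- Chunk 66a is a chunk of decade 6. [folklore] -/
theorem rank2Rows66a_mem_decade6 : rank2Rows66a ∈ rank2Decade6Chunks :=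
  List.mem_iff_getElem?.mpr ⟨12, rfl⟩

/-- Chunk 66b is a chunk of decade 6. [folklore] -/
theorem rank2Rows66b_mem_decade6 : rank2Rows66b ∈ rank2Decade6Chunks :=
  List.mem_iff_getElem?.mpr ⟨13, rfl⟩

/-- Chunk 67a is a chunk of decade 6. [folklore] -/
theorem rank2Rows67a_mem_decade6 : rank2Rows67a ∈ rank2Decade6Chunks :=
  List.mem_iff_getElem?.mpr ⟨14, rfl⟩

/-- Chunk 67b is a chunk of decade 6. [folklore] -/
theorem rank2Rows67b_mem_decade6 : rank2Rows67b ∈ rank2Decade6Chunks :=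
  List.mem_iff_getElem?.mpr ⟨15, rfl⟩

/-- Chunk 68a is a chunk of decade 6. [folklore] -/
theorem rank2Rows68a_mem_decade6 : rank2Rows68a ∈ rank2Decade6Chunks :=
  List.mem_iff_getElem?.mpr ⟨16, rfl⟩

/-- Chunk 68b is a chunk of decade 6. [folklore] -/
theorem rank2Rows68b_mem_decade6 : rank2Rows68b ∈ rank2Decade6Chunks :=
  List.mem_iff_getElem?.mpr ⟨17, rfl⟩

/-- Chunk 69a is a chunk of decade 6. [folklore] -/
theorem rank2Rows69a_mem_decade6 : rank2Rows69a ∈ rank2Decade6Chunks :=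
  List.mem_iff_getElem?.mpr ⟨18, rfl⟩

/-- Chunk 69b is a chunk of decade 6. [folklore] -/
theorem rank2Rows69b_mem_decade6 : rank2Rows69b ∈ rank2Decade6Chunks :=
  List.mem_iff_getElem?.mpr ⟨19, rfl⟩

end Summit.BirchSwinnertonDyer.BirchSwinnertonDyer.Rank2Observatory
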